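import Mathlib.Algebra.MonoidAlgebra.MapDomain
import Literature.Algebra.Lie.FreeLieRingEmbedding
import HarnessLib

/-!
# Witt's embedding theorem for an arbitrary alphabet

Topic `Literature/Algebra/Lie`. `Literature/Algebra/Lie/FreeLieRingEmbedding.lean` proves that the
canonical map `φ : L_ℤ(X) → ℤ[FreeMonoid X]` (`toTensor ℤ X`) is injective for a FINITE alphabet
`X` (Witt 1937). Here the finiteness assumption is removed (`toTensor_int_injective_of_any`) by the
standard finite-support reduction: every element of `L_ℤ(X)` comes from `L_ℤ(s)` for a finite
`s ⊆ X` (`exists_finset_mem_range_mapLie`), the maps `L_ℤ(s) → L_ℤ(X)` and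
`ℤ[FreeMonoid s] → ℤ[FreeMonoid X]` induced by the inclusion intertwine `φ` (`toTensor_mapLie`), and
the latter is injective (`mapTensor_injective`). Also recorded: functoriality of `L_ℤ(-)` in the
alphabet (`mapLie`, `mapLie_comp`).

Everything is proved; there are no named facts.

## References

* E. Witt, Treue Darstellung Liescher Ringe, J. reine angew. Math. 177 (1937), Satz 3.
* N. Bourbaki, *Lie groups and Lie algebras*, Ch. II §3 no. 1, Theorem 1 and §2.5 (functoriality).
-/

noncomputable section

namespace Literature.Algebra.Lie

-- Mathlib idiom: the commutator bracket on an associative algebra.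
attribute [local instance 100] LieRing.ofAssociativeRing

section Functoriality

variable {X X' X'' : Type*}

/-- Change of alphabet `L_ℤ(X) → L_ℤ(X')` along `f : X → X'`. [folklore] -/
def mapLie (f : X → X') : FreeLieAlgebra ℤ X →ₗ⁅ℤ⁆ FreeLieAlgebra ℤ X' :=
  FreeLieAlgebra.lift ℤ (FreeLieAlgebra.of ℤ ∘ f)

/-- `mapLie f` on letters. [folklore] -/
@[simp] theorem mapLie_of (f : X → X') (x : X) : mapLie f (FreeLieAlgebra.of ℤ x) = FreeLieAlgebra.of ℤ (f x) :=
  FreeLieAlgebra.lift_of_apply _ x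

/-- Functoriality: `mapLie (h ∘ f) = mapLie h ∘ mapLie f`. [folklore] -/
theorem mapLie_comp (f : X → X') (h : X' → X'') (u : FreeLieAlgebra ℤ X) :
    mapLie (h ∘ f) u = mapLie h (mapLie f u) := by
  -- pointwise, through the instance-free extensionality principle for additive bracket-preserving maps
  have key : (mapLie (h ∘ f)).toLinearMap.toAddMonoidHom =
      ((mapLie h).toLinearMap.toAddMonoidHom).comp (mapLie f).toLinearMap.toAddMonoidHom := by
    refine addMonoidHom_ext_of_map_lie ?_ ?_ ?_
    · intro a b; exact (mapLie (h ∘ f)).map_lie a b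
    · intro a b
      change mapLie h (mapLie f ⁅a, b⁆) = ⁅mapLie h (mapLie f a), mapLie h (mapLie f b)⁆
      rw [LieHom.map_lie, LieHom.map_lie]
    · intro x
      change mapLie (h ∘ f) (FreeLieAlgebra.of ℤ x) = mapLie h (mapLie f (FreeLieAlgebra.of ℤ x))
      rw [mapLie_of, mapLie_of, mapLie_of]; rfl
  exact DFunLike.congr_fun key u

/-- Change of alphabet `ℤ[FreeMonoid X] → ℤ[FreeMonoid X']` along `f`. [folklore] -/
def mapTensor (f : X → X') : MonoidAlgebra ℤ (FreeMonoid X) →+* MonoidAlgebra ℤ (FreeMonoid X') :=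
  MonoidAlgebra.mapDomainRingHom ℤ (FreeMonoid.map f)

/-- `mapTensor f` on words. [folklore] -/
@[simp] theorem mapTensor_single (f : X → X') (w : FreeMonoid X) (c : ℤ) :
    mapTensor f (MonoidAlgebra.single w c) = MonoidAlgebra.single (FreeMonoid.map f w) c := by
  simp [mapTensor]

/-- `mapTensor f` is injective for injective `f`. [folklore] -/
theorem mapTensor_injective {f : X → X'} (hf : Function.Injective f) : Function.Injective (mapTensor f) := by
  intro a b h
  have hmap : Function.Injective (FreeMonoid.map f) := fun u v huv =>
    FreeMonoid.toList.injective ((List.map_injective_iff.2 hf) (by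
      simpa [FreeMonoid.toList_map] using congrArg FreeMonoid.toList huv))
  apply MonoidAlgebra.coeff_injective
  have := congrArg MonoidAlgebra.coeff h
  simp only [mapTensor, MonoidAlgebra.mapDomainRingHom_apply, MonoidAlgebra.coeff_mapDomain] at this
  exact Finsupp.mapDomain_injective hmap this

/-- The embeddings are natural in the alphabet: `φ_{X'} ∘ mapLie f = mapTensor f ∘ φ_X`. [folklore] -/
theorem toTensor_mapLie (f : X → X') (u : FreeLieAlgebra ℤ X) :
    toTensor ℤ X' (mapLie f u) = mapTensor f (toTensor ℤ X u) := by
  have key : ((toTensor ℤ X').toLinearMap.toAddMonoidHom).comp (mapLie f).toLinearMap.toAddMonoidHom =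
      ((mapTensor f : MonoidAlgebra ℤ (FreeMonoid X) →+ _).comp (toTensor ℤ X).toLinearMap.toAddMonoidHom) := by
    refine addMonoidHom_ext_of_map_lie ?_ ?_ ?_
    · intro a b
      change toTensor ℤ X' (mapLie f ⁅a, b⁆) = ⁅toTensor ℤ X' (mapLie f a), toTensor ℤ X' (mapLie f b)⁆
      rw [LieHom.map_lie, LieHom.map_lie]
    · intro a b
      change mapTensor f (toTensor ℤ X ⁅a, b⁆) = ⁅mapTensor f (toTensor ℤ X a), mapTensor f (toTensor ℤ X b)⁆
      rw [LieHom.map_lie, LieRing.of_associative_ring_bracket, LieRing.of_associative_ring_bracket,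
        map_sub, map_mul, map_mul]
    · intro x
      change toTensor ℤ X' (mapLie f (FreeLieAlgebra.of ℤ x)) = mapTensor f (toTensor ℤ X (FreeLieAlgebra.of ℤ x))
      rw [mapLie_of, toTensor_of, toTensor_of, mapTensor_single]
      rfl
  exact DFunLike.congr_fun key u

/-- **Finite support**: every element of `L_ℤ(X)` comes from `L_ℤ(s)` for a finite subset `s ⊆ X`.
[folklore] -/
theorem exists_finset_mem_range_mapLie [DecidableEq X] (u : FreeLieAlgebra ℤ X) :
    ∃ s : Finset X, u ∈ (mapLie (Subtype.val : ↥s → X)).range := by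
  -- ranges grow with the finite set
  have mono : ∀ {s t : Finset X}, s ⊆ t → ∀ {v}, v ∈ (mapLie (Subtype.val : ↥s → X)).range →
      v ∈ (mapLie (Subtype.val : ↥t → X)).range := by
    intro s t hst v hv
    obtain ⟨w, rfl⟩ := hv
    refine ⟨mapLie (fun y : ↥s => (⟨y.1, hst y.2⟩ : ↥t)) w, ?_⟩
    change mapLie Subtype.val (mapLie _ w) = mapLie Subtype.val w
    rw [← mapLie_comp]
    rfl
  refine freeLieAlgebra_int_induction (P := fun u => ∃ s : Finset X, u ∈ (mapLie (Subtype.val : ↥s → X)).range)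
    u ?_ ?_ ?_ ?_ ?_
  · intro x
    refine ⟨{x}, FreeLieAlgebra.of ℤ ⟨x, Finset.mem_singleton_self x⟩, ?_⟩
    exact mapLie_of _ _
  · exact ⟨∅, zero_mem _⟩
  · rintro a b ⟨s, ha⟩ ⟨t, hb⟩
    exact ⟨s ∪ t, add_mem (mono Finset.subset_union_left ha) (mono Finset.subset_union_right hb)⟩
  · rintro a ⟨s, ha⟩
    exact ⟨s, neg_mem ha⟩
  · rintro a b ⟨s, ha⟩ ⟨t, hb⟩
    exact ⟨s ∪ t, (mapLie (Subtype.val : ↥(s ∪ t) → X)).range.lie_mem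
      (mono Finset.subset_union_left ha) (mono Finset.subset_union_right hb)⟩

end Functoriality

/-- **Witt's embedding theorem, arbitrary alphabet**: the canonical map from the free Lie ring
`L_ℤ(X)` to the free associative ring `ℤ[FreeMonoid X]` is injective.
(Witt 1937, Satz 3.) [cite: Bourbaki2006LieGroups23, Ch. II §3 no. 1 Thm. 1] -/
theorem toTensor_int_injective_of_any (X : Type*) : Function.Injective (toTensor ℤ X) := by
  classical
  intro u v huv
  rw [← sub_eq_zero] at huv ⊢
  rw [← map_sub] at huv
  obtain ⟨s, w, hw⟩ := exists_finset_mem_range_mapLie (u - v)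
  change mapLie Subtype.val w = u - v at hw
  rw [← hw] at huv ⊢
  rw [toTensor_mapLie] at huv
  have h1 : toTensor ℤ (↥s) w = 0 :=
    mapTensor_injective Subtype.val_injective (by rw [huv, map_zero])
  have h2 : w = 0 := toTensor_int_injective (↥s) (by rw [h1, map_zero])
  rw [h2, map_zero]

end Literature.Algebra.Lie
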